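import Literature.MathematicalPhysics.QuantumFieldTheory.Balaban1983to89.B8Eq1117Concrete

/-!
# `Balaban1983to89.B8Eq1113Concrete` — T. Bałaban, *Spaces of regular gauge field configurations on a lattice and gauge
# fixing conditions*, Commun. Math. Phys. **99** (1985) 75–102 [Balaban1985RegularSpaces], Sect. E pp. 95–97: the solution `D′(λ)` of
# (1.117) («We take `D′(λ)` equal to this solution»), its bound «`|D′(λ)| = |C′(λ − H′D′(λ))| < C′₂(α₃ + α₄)α₄`», and the linearizing
# transformation (1.113) with (1.114) `Q′(λ − H′D′(λ)) = Q′λ` — FOR THE CONCRETE LATTICE REMAINDER `C′ = C′_j(u₁, ·)` of (213) [3]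

statement-level skeleton of published theorems with citation tags; proofs where landed; nothing here is a claim about the Yang–Mills mass gap

PDF held: `paper:balaban1985-cmp99-regular-spaces-gauge-fixing` (journal page = PDF page + 74); pp. 96–97 read AS IMAGES on the
renders `run/shared/lean/pub/pub-balaban/b2b-balaban-ref1/pages/1985-cmp99-regular-spaces-gauge-fixing/…-p022-x2.png`, `…-p023-x2.png`,
p. 95 [PDF 21] from the text layer (this unit, 2026-08-21); [3] = T. Bałaban, *Averaging operations for lattice gauge theories*, Commun.
Math. Phys. **98** (1985) 17–51 [Balaban1985Averaging], (213)–(214) p. 50.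

CITATION HEADER (lean-in-tree rule).  Cell `lit-balaban` (HOME `run/shared/lean/pub/lit-balaban/`), unit `lit-balaban-p05` (Phase-2 proof
seat p05, gen 5; TAKING line HOME/STATUS.md 2026-08-21T07:14Z; free-target protocol G.5-34(d); owner of block B8 = `lit-balaban-r05`,
referee ref-4).  WHAT IS REPRODUCED = SKELETON rows **`B8.Eq1.113`** ((1.113)–(1.118) pp. 95–96) and the `D′` sentences of p. 97 (row
**`B8.Claim@97`**'s neighbourhood), typed/proved so far AT THE ABSTRACT BANACH LEVEL in r05's `B8SectEStatements` (`Dprime`, `Dprime_spec`,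
`Dprime_unique`, `Dprime_bound`, `linMap`, `eq1114`, `eq1114_Dprime`) — HERE for the CONCRETE lattice remainder `C′ = C′_j(u₁, ·)` =
`B8Eq1123Concrete.Cnl`, on top of FILE 1 of this pair `B8Eq1117Concrete` (the `X`-space `XSpace`, the transformation (1.118) `fpMap` and
«exactly one solution of Eq. (1.117)» `eq1117_existsUnique`), with the operator `H′` of (1.91)–(1.92) kept ABSTRACT (any `ℂ`-linear map
with the (1.92)/(1.120)-type modulus bounds; for (1.114) also `Q′H′ = I`).

PRINT (pp. 95–97 [PDF 21–23], verbatim).  «We want to construct a function `D′(λ)` for `α₃, α₄` sufficiently small, whose values are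
configurations `X : 𝔅_k → 𝔤`, such that the transformation `λ′ = λ − H′D′(λ)` (1.113) changes the function `Q′(λ′)` into the linear
function `Q′λ`: `Q′(λ − H′D′(λ)) = Q′λ`. (1.114)  Using the equality (213) [3] the above equation can be written in the following form:
`Q′λ − Q′H′D′(λ) + C′(λ − H′D′(λ)) = Q′λ`, (1.115) hence `−D′(λ) + C′(λ − H′D′(λ)) = 0`. (1.116)  The function `D′(λ)` is a solution of
the equation `C′(λ − H′X) = X`, (1.117) …»  (p. 97) «Thus by the contraction mapping theorem there exists exactly one solution of
Eq. (1.117). This solution is an analytic function of `λ` defined on the set of `λ` satisfying (1.119). We take `D′(λ)` equal to this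
solution. From Eq. (1.116) we can get much better bounds on it: `|D′(λ)| = |C′(λ − H′D′(λ))| < C′₂(α₃ + α₄)α₄`.»  (p. 96) «`Q′H′ = I`».

WHAT THIS FILE PROVES (kernel, no `sorry`, standard axioms; carriers, data and hypotheses of `B8Eq1117Concrete.eq1117_existsUnique`).
* §3 `Dprime` — «We take `D′(λ)` equal to this solution» (by choice: the fixed point of (1.118) in the closed ball of radius `ρ = α₄/(2B′₀)`
  when one exists, `0` otherwise — as `B8SectEStatements.Dprime`); `Dprime_spec_of_exists`; **`Dprime_spec`** — `D′(λ)` lies in the ball,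
  solves (1.117), and is the only solution there (from `eq1117_existsUnique`); **`Dprime_bound`** — «`|D′(λ)| = |C′(λ − H′D′(λ))| <
  C′₂(α₃ + α₄)α₄`» with `≤` and `C′₂ = C2p d` ((1.121) `B8Eq1117Concrete.norm_Cnl_le_of207` at `λ − H′D′(λ)`); `eq1114_of_fixedPoint` —
  the algebra (1.115)–(1.116): a sitewise solution of (1.117) plus `Q′H′ = I` gives (1.114), by (213) (the definition of `Cnl`) and the
  linearity of `Q′_j` (`B8Eq1123Concrete.QprimeIter_line`); **`eq1114_Dprime`** — (1.114) `Q′_j(u₁, λ − H′D′(λ))(z) = (Q′_jλ)(z)` for all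
  `j ≤ k`, `z`, for the constructed `D′` and any abstract `H′` with the modulus bounds and `Q′H′ = I`.
READINGS (recorded; none is an objection to print): those of `B8Eq1117Concrete` ((a) carriers / one-level (207)-domain / `𝔅_k` = all levels
`j ≤ k` and sites; (b) `H′` abstract with `‖(H′X)(x)‖ ≤ B′₀‖X‖`, `‖R(U₀(b))(H′X)(b₊) − (H′X)(b₋)‖ ≤ B′₀‖X‖·L⁻ᵏ`, here also `Q′H′ = I` sitewise;
(c) constants `C′₂ := 2·C2p d` in the smallness «`α₃ + α₄ ≦ 1/(4B′₀C′₂)`» and the (214)-hypotheses at `2α₄` (HOME/GAPS.md G-B8-17); (d) `≤`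
for `<` and the closed ball for (1.119)).  NOT CLAIMED: «This solution is an analytic function of `λ`»; the lattice `H′`; the onto sentence of
p. 97 (`B8Claim97OntoProof`, abstract).
DECLARATIONS: 1 definition with body (`Dprime`), the rest theorems; no `… : Prop` fact is introduced.  REUSED BY NAME:
`B8Eq1117Concrete.XSpace, CnlF, CnlF_apply, fpMap, eq1117_existsUnique, eq1117_pointwise, norm_Cnl_le_of207, dom120_of_119`,
`B8Eq1123Concrete.Cnl, QprimeIter_line`, `B8Ineq125Concrete.C2p, C2p_nonneg`, `B8Eq178Averages.Qnl`, `B7Eq78Linearization.QprimeIter,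
zdBlocking`, `B8Eq119TwistedAxial.bgT`, `B7Prop10Flat.one_le_C5, C4'_nonneg, C5'_nonneg`, `B7Prop10General.C6, C7, C4G`, Mathlib
`BoundedContinuousFunction.norm_le`.
Unit `lit-balaban-p05` (gen 5), 2026-08-21.

[cite: Balaban1985RegularSpaces, (1.113)–(1.118) pp.95–96, p.97 (D′ and its bound), (1.121) p.96; Balaban1985Averaging, (213)–(214) p.50]
-/

noncomputable section

open NormedSpace Finset Metric Set
open scoped BoundedContinuousFunction

namespace Literature.MathematicalPhysics.QuantumFieldTheory.Balaban1983to89.B8Eq1113Concrete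

open B7Prop1Explicit B7Prop2Explicit MatrixLog B7Eq167Flat B7Prop9Flat B7Prop10General
open B7Prop10Flat (one_le_C5 C4'_nonneg C5'_nonneg)
open B7Eq78Linearization (zdBlocking QprimeIter)
open B7Eq214General (Cgen)
open B7Eq170Flat (cj)
open B8Eq119TwistedAxial (bgT)
open B8Eq178Averages (Qnl)
open B8Eq1123Concrete (Cnl)
open B8Ineq125Concrete (C2p C2p_nonneg)
open B8Eq1117Concrete (XSpace CnlF CnlF_apply fpMap eq1117_existsUnique eq1117_pointwise norm_Cnl_le_of207 dom120_of_119)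

-- `Site` alone would resolve to the torus sites of `Setup.lean`; re-export the `ℤ^d` sites of `B7Prop1Explicit`.
export B7Prop1Explicit (Site)

variable {d : ℕ}

/-! ## §3 `D′(λ)`, its bound, and (1.114) -/

section Dprime

variable {𝔸 : Type*} [NormedRing 𝔸] [NormOneClass 𝔸] [NormedAlgebra ℂ 𝔸] [CompleteSpace 𝔸]

omit [NormOneClass 𝔸] in
open Classical in
/-- **`D′(λ)`** — p. 97: «We take `D′(λ)` equal to this solution» [of (1.117) in the set `|X| < α₄/(2B′₀)`]: by choice, the fixed point
of (1.118) in the closed ball of radius `ρ` (= `α₄/(2B′₀)`) when one exists, `0` otherwise (as in `B8SectEStatements.Dprime`).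
[cite: Balaban1985RegularSpaces, p.97 (definition of D′), (1.117) p.96] -/
def Dprime (L : ℕ) (U₀ : Site d → Fin d → 𝔸ˣ) (u₁ : Site d → 𝔸ˣ) (k : ℕ) (H' : XSpace d k 𝔸 →ₗ[ℂ] (Site d → 𝔸)) (ρ : ℝ)
    (lam : Site d → 𝔸) : XSpace d k 𝔸 :=
  if h : ∃ X : XSpace d k 𝔸, ‖X‖ ≤ ρ ∧ fpMap L U₀ u₁ k H' lam X = X then h.choose else 0

omit [NormOneClass 𝔸] in
/-- If (1.118) has a fixed point in the ball of radius `ρ`, `D′(λ)` is one. [cite: Balaban1985RegularSpaces, p.97 (definition of D′)]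
(elementary API; our proof) -/
theorem Dprime_spec_of_exists {L : ℕ} {U₀ : Site d → Fin d → 𝔸ˣ} {u₁ : Site d → 𝔸ˣ} {k : ℕ}
    {H' : XSpace d k 𝔸 →ₗ[ℂ] (Site d → 𝔸)} {ρ : ℝ} {lam : Site d → 𝔸}
    (h : ∃ X : XSpace d k 𝔸, ‖X‖ ≤ ρ ∧ fpMap L U₀ u₁ k H' lam X = X) :
    ‖Dprime L U₀ u₁ k H' ρ lam‖ ≤ ρ ∧ fpMap L U₀ u₁ k H' lam (Dprime L U₀ u₁ k H' ρ lam) = Dprime L U₀ u₁ k H' ρ lam := by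
  unfold Dprime
  rw [dif_pos h]
  exact h.choose_spec

/-- **`D′(λ)` solves (1.117) in the ball `‖X‖ ≤ α₄/(2B′₀)` and is the only solution there** («exactly one solution … We take `D′(λ)`
equal to this solution», p. 97), for the concrete `C′` under the hypotheses of `eq1117_existsUnique`.
[cite: Balaban1985RegularSpaces, p.97 (definition of D′), (1.117) p.96] -/
theorem Dprime_spec {L : ℕ} (hL : 2 ≤ L) {G : Subgroup 𝔸ˣ} (hG : AvgClosed d L G) {U₀ : Site d → Fin d → 𝔸ˣ}
    (hU : ∀ x κ, U₀ x κ ∈ G) {k : ℕ} (H' : XSpace d k 𝔸 →ₗ[ℂ] (Site d → 𝔸)) (lam : Site d → 𝔸)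
    {u₁ : Site d → 𝔸ˣ} {α₀ α₃ α₄ B₀' : ℝ}
    (hα : 0 < α₀) (hα3 : C0 d * α₀ ≤ 1 / 3) (hα2 : 2 * α₀ ≤ c2' d L)
    (h52 : pdev U₀ < α₀ * (((L : ℝ) ^ k)⁻¹) ^ 2)
    (hB : 0 < B₀')
    (hH0 : ∀ (X : XSpace d k 𝔸) (x : Site d), ‖H' X x‖ ≤ B₀' * ‖X‖)
    (hH1 : ∀ (X : XSpace d k 𝔸) (x : Site d) (κ : Fin d),
      ‖cj (U₀ x κ) (H' X (x + e κ)) - H' X x‖ ≤ B₀' * ‖X‖ * ((L : ℝ) ^ k)⁻¹)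
    (h119a : ∀ (x : Site d) (κ : Fin d), ‖cj (U₀ x κ) (lam (x + e κ)) - lam x‖ < α₄ / 2 * ((L : ℝ) ^ k)⁻¹)
    (h119b : ∀ x : Site d, ‖lam x‖ < α₄ / 2)
    (hu₁ : InLambda L U₀ u₁ k α₃ (((L : ℝ) ^ k)⁻¹))
    (hα₃ : 0 ≤ α₃) (hα₃' : α₃ ≤ 1 / 200)
    (hs₁ : 200 * C6 d * (2 * α₄) ≤ 1) (hs₂ : 12000 * ((d : ℝ) + 1) * L * (2 * α₄) ≤ 1)
    (hs₃ : C4G d L * (α₀ + α₃ + 4 * (2 * α₄)) ≤ 1)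
    (hs₄ : 1024 * ((d : ℝ) + 1) * ((d : ℝ) + 4) * L ^ 2 * α₀ ≤ 1) (hs₅ : 32 * ((d : ℝ) + 1) ^ 2 * C6 d * L ^ 2 * α₀ ≤ 1)
    (hs₆ : 16 * d * C5' d * C6 d * (L : ℝ) ^ 2 * α₀ ≤ 1) (hs₇ : 8 * d * C6 d * L * α₀ ≤ 1)
    (hsm : α₃ + α₄ ≤ 1 / (4 * B₀' * (2 * C2p d))) :
    (‖Dprime L U₀ u₁ k H' (α₄ / (2 * B₀')) lam‖ ≤ α₄ / (2 * B₀') ∧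
      fpMap L U₀ u₁ k H' lam (Dprime L U₀ u₁ k H' (α₄ / (2 * B₀')) lam) = Dprime L U₀ u₁ k H' (α₄ / (2 * B₀')) lam) ∧
      ∀ X : XSpace d k 𝔸, ‖X‖ ≤ α₄ / (2 * B₀') → fpMap L U₀ u₁ k H' lam X = X →
        X = Dprime L U₀ u₁ k H' (α₄ / (2 * B₀')) lam := by
  have hu := eq1117_existsUnique hL hG hU H' lam hα hα3 hα2 h52 hB hH0 hH1 h119a h119b hu₁ hα₃ hα₃' hs₁ hs₂ hs₃ hs₄ hs₅ hs₆
    hs₇ hsm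
  have hD := Dprime_spec_of_exists hu.exists
  exact ⟨hD, fun X hX hfix => hu.unique ⟨hX, hfix⟩ hD⟩

/-- **The bound on `D′`** — p. 97: «From Eq. (1.116) we can get much better bounds on it: `|D′(λ)| = |C′(λ − H′D′(λ))| <
C′₂(α₃ + α₄)α₄`» (`≤`, READING (d); `C′₂ = C2p d` here) — from (1.117) for `D′(λ)` and (1.121) at `λ − H′D′(λ)`.
[cite: Balaban1985RegularSpaces, p.97 (bound on D′ after (1.125)), (1.121) p.96] -/
theorem Dprime_bound {L : ℕ} (hL : 2 ≤ L) {G : Subgroup 𝔸ˣ} (hG : AvgClosed d L G) {U₀ : Site d → Fin d → 𝔸ˣ}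
    (hU : ∀ x κ, U₀ x κ ∈ G) {k : ℕ} (H' : XSpace d k 𝔸 →ₗ[ℂ] (Site d → 𝔸)) (lam : Site d → 𝔸)
    {u₁ : Site d → 𝔸ˣ} {α₀ α₃ α₄ B₀' : ℝ}
    (hα : 0 < α₀) (hα3 : C0 d * α₀ ≤ 1 / 3) (hα2 : 2 * α₀ ≤ c2' d L)
    (h52 : pdev U₀ < α₀ * (((L : ℝ) ^ k)⁻¹) ^ 2)
    (hB : 0 < B₀')
    (hH0 : ∀ (X : XSpace d k 𝔸) (x : Site d), ‖H' X x‖ ≤ B₀' * ‖X‖)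
    (hH1 : ∀ (X : XSpace d k 𝔸) (x : Site d) (κ : Fin d),
      ‖cj (U₀ x κ) (H' X (x + e κ)) - H' X x‖ ≤ B₀' * ‖X‖ * ((L : ℝ) ^ k)⁻¹)
    (h119a : ∀ (x : Site d) (κ : Fin d), ‖cj (U₀ x κ) (lam (x + e κ)) - lam x‖ < α₄ / 2 * ((L : ℝ) ^ k)⁻¹)
    (h119b : ∀ x : Site d, ‖lam x‖ < α₄ / 2)
    (hu₁ : InLambda L U₀ u₁ k α₃ (((L : ℝ) ^ k)⁻¹))
    (hα₃ : 0 ≤ α₃) (hα₃' : α₃ ≤ 1 / 200)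
    (hs₁ : 200 * C6 d * (2 * α₄) ≤ 1) (hs₂ : 12000 * ((d : ℝ) + 1) * L * (2 * α₄) ≤ 1)
    (hs₃ : C4G d L * (α₀ + α₃ + 4 * (2 * α₄)) ≤ 1)
    (hs₄ : 1024 * ((d : ℝ) + 1) * ((d : ℝ) + 4) * L ^ 2 * α₀ ≤ 1) (hs₅ : 32 * ((d : ℝ) + 1) ^ 2 * C6 d * L ^ 2 * α₀ ≤ 1)
    (hs₆ : 16 * d * C5' d * C6 d * (L : ℝ) ^ 2 * α₀ ≤ 1) (hs₇ : 8 * d * C6 d * L * α₀ ≤ 1)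
    (hsm : α₃ + α₄ ≤ 1 / (4 * B₀' * (2 * C2p d))) :
    ‖Dprime L U₀ u₁ k H' (α₄ / (2 * B₀')) lam‖ ≤ C2p d * (α₃ + α₄) * α₄ := by
  obtain ⟨⟨hball, hfix⟩, -⟩ := Dprime_spec hL hG hU H' lam hα hα3 hα2 h52 hB hH0 hH1 h119a h119b hu₁ hα₃ hα₃' hs₁ hs₂ hs₃
    hs₄ hs₅ hs₆ hs₇ hsm
  have hα₄ : 0 < α₄ := by linarith [norm_nonneg (lam 0), h119b 0]
  have hs : (0 : ℝ) ≤ ((L : ℝ) ^ k)⁻¹ := by positivity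
  have hC6 : (0 : ℝ) ≤ C6 d := by unfold C6; linarith [one_le_C5 (d := d)]
  have hC4G : 0 ≤ C4G d L := by
    have h7 : (0 : ℝ) ≤ C7 d := by unfold C7 C6; linarith [one_le_C5 (d := d), C5'_nonneg (d := d)]
    have h4' := C4'_nonneg (d := d)
    unfold C4G; positivity
  have hs₁' : 200 * C6 d * α₄ ≤ 1 := by nlinarith
  have hs₂' : 12000 * ((d : ℝ) + 1) * L * α₄ ≤ 1 := by
    have : (0 : ℝ) ≤ 12000 * ((d : ℝ) + 1) * L := by positivity
    nlinarith
  have hs₃' : C4G d L * (α₀ + α₃ + 4 * α₄) ≤ 1 := by nlinarith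
  set D := Dprime L U₀ u₁ k H' (α₄ / (2 * B₀')) lam with hDdef
  obtain ⟨ha, hb⟩ := dom120_of_119 H' hB hs hH0 hH1 h119a h119b hball
  have hbdd : ∃ C : ℝ, ∀ p : Fin (k + 1) × Site d, ‖Cnl L U₀ u₁ p.1 (lam - H' D) p.2‖ ≤ C :=
    ⟨C2p d * (α₃ + α₄) * α₄, fun p => norm_Cnl_le_of207 hL hG hU hα hα3 hα2 h52 ha hb hu₁ hα₃ hα₃' hs₁' hs₂' hs₃' hs₄ hs₅ hs₆
      hs₇ p.1 (Nat.le_of_lt_succ p.1.isLt) p.2⟩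
  rw [← hfix]
  have h0 : 0 ≤ C2p d * (α₃ + α₄) * α₄ := by have := C2p_nonneg d; positivity
  refine (BoundedContinuousFunction.norm_le h0).2 fun p => ?_
  rw [fpMap, CnlF_apply hbdd]
  exact norm_Cnl_le_of207 hL hG hU hα hα3 hα2 h52 ha hb hu₁ hα₃ hα₃' hs₁' hs₂' hs₃' hs₄ hs₅ hs₆ hs₇ p.1
    (Nat.le_of_lt_succ p.1.isLt) p.2

omit [NormOneClass 𝔸] in
/-- **(1.114) from (1.115)–(1.117)**, the algebra (p. 96: «`Q′λ − Q′H′D′(λ) + C′(λ − H′D′(λ)) = Q′λ`, (1.115) hence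
`−D′(λ) + C′(λ − H′D′(λ)) = 0`. (1.116)»), for the concrete `Q′_j(u₁, ·) = Qnl` and `Q′_j = QprimeIter (zdBlocking d L) (bgT L U₀) j`:
if `X` solves (1.117) sitewise (`C′_j(u₁, λ − H′X)(z) = X(j, z)`) and `Q′H′ = I` (`(Q′_j(H′X))(z) = X(j, z)`, p. 96), then
`Q′_j(u₁, λ − H′X)(z) = (Q′_jλ)(z)`. [cite: Balaban1985RegularSpaces, (1.114)–(1.116) p.96] -/
theorem eq1114_of_fixedPoint {L : ℕ} {U₀ : Site d → Fin d → 𝔸ˣ} {u₁ : Site d → 𝔸ˣ} {k : ℕ}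
    (H' : XSpace d k 𝔸 →ₗ[ℂ] (Site d → 𝔸)) {lam : Site d → 𝔸} {X : XSpace d k 𝔸}
    (hQH : ∀ (Y : XSpace d k 𝔸) (j : ℕ) (hj : j ≤ k) (z : Site d),
      QprimeIter (zdBlocking d L) (bgT L U₀) j (H' Y) z = Y (⟨j, Nat.lt_succ_of_le hj⟩, z))
    (hfix : ∀ (j : ℕ) (hj : j ≤ k) (z : Site d), Cnl L U₀ u₁ j (lam - H' X) z = X (⟨j, Nat.lt_succ_of_le hj⟩, z)) :
    ∀ (j : ℕ), j ≤ k → ∀ z : Site d,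
      Qnl L U₀ (fun x => expUnit ((lam - H' X) x)) u₁ j z = QprimeIter (zdBlocking d L) (bgT L U₀) j lam z := by
  intro j hj z
  -- (213): `Q′(u₁, μ) = Q′μ + C′(μ)` is the definition of `Cnl`
  have h213 : Qnl L U₀ (fun x => expUnit ((lam - H' X) x)) u₁ j z =
      QprimeIter (zdBlocking d L) (bgT L U₀) j (lam - H' X) z + Cnl L U₀ u₁ j (lam - H' X) z := by
    rw [Cnl]; abel
  -- linearity of `Q′_j`: `Q′(λ − H′X) = Q′λ − Q′H′X`
  have hlin : QprimeIter (zdBlocking d L) (bgT L U₀) j (lam - H' X) z =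
      QprimeIter (zdBlocking d L) (bgT L U₀) j lam z - QprimeIter (zdBlocking d L) (bgT L U₀) j (H' X) z := by
    have h1 : lam - H' X = lam + (-1 : ℂ) • H' X := by rw [neg_one_smul, sub_eq_add_neg]
    rw [h1, B8Eq1123Concrete.QprimeIter_line, neg_one_smul, sub_eq_add_neg]
  rw [h213, hlin, hQH X j hj z, hfix j hj z]
  abel

/-- **(1.114) for the constructed `D′`**: «the transformation `λ′ = λ − H′D′(λ)` (1.113) changes the function `Q′(λ′)` into the linear
function `Q′λ`: `Q′(λ − H′D′(λ)) = Q′λ`. (1.114)» — for the concrete `C′`, `Q′_j(u₁, ·)`, `Q′_j`, any abstract `H′` with the modulus bounds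
and `Q′H′ = I`, and `λ` in (1.119): `Q′_j(u₁, λ − H′D′(λ))(z) = (Q′_jλ)(z)` for all `j ≤ k`, `z`.
[cite: Balaban1985RegularSpaces, (1.113)–(1.114) p.95–96] -/
theorem eq1114_Dprime {L : ℕ} (hL : 2 ≤ L) {G : Subgroup 𝔸ˣ} (hG : AvgClosed d L G) {U₀ : Site d → Fin d → 𝔸ˣ}
    (hU : ∀ x κ, U₀ x κ ∈ G) {k : ℕ} (H' : XSpace d k 𝔸 →ₗ[ℂ] (Site d → 𝔸)) (lam : Site d → 𝔸)
    {u₁ : Site d → 𝔸ˣ} {α₀ α₃ α₄ B₀' : ℝ}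
    (hα : 0 < α₀) (hα3 : C0 d * α₀ ≤ 1 / 3) (hα2 : 2 * α₀ ≤ c2' d L)
    (h52 : pdev U₀ < α₀ * (((L : ℝ) ^ k)⁻¹) ^ 2)
    (hB : 0 < B₀')
    (hH0 : ∀ (X : XSpace d k 𝔸) (x : Site d), ‖H' X x‖ ≤ B₀' * ‖X‖)
    (hH1 : ∀ (X : XSpace d k 𝔸) (x : Site d) (κ : Fin d),
      ‖cj (U₀ x κ) (H' X (x + e κ)) - H' X x‖ ≤ B₀' * ‖X‖ * ((L : ℝ) ^ k)⁻¹)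
    (hQH : ∀ (Y : XSpace d k 𝔸) (j : ℕ) (hj : j ≤ k) (z : Site d),
      QprimeIter (zdBlocking d L) (bgT L U₀) j (H' Y) z = Y (⟨j, Nat.lt_succ_of_le hj⟩, z))
    (h119a : ∀ (x : Site d) (κ : Fin d), ‖cj (U₀ x κ) (lam (x + e κ)) - lam x‖ < α₄ / 2 * ((L : ℝ) ^ k)⁻¹)
    (h119b : ∀ x : Site d, ‖lam x‖ < α₄ / 2)
    (hu₁ : InLambda L U₀ u₁ k α₃ (((L : ℝ) ^ k)⁻¹))
    (hα₃ : 0 ≤ α₃) (hα₃' : α₃ ≤ 1 / 200)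
    (hs₁ : 200 * C6 d * (2 * α₄) ≤ 1) (hs₂ : 12000 * ((d : ℝ) + 1) * L * (2 * α₄) ≤ 1)
    (hs₃ : C4G d L * (α₀ + α₃ + 4 * (2 * α₄)) ≤ 1)
    (hs₄ : 1024 * ((d : ℝ) + 1) * ((d : ℝ) + 4) * L ^ 2 * α₀ ≤ 1) (hs₅ : 32 * ((d : ℝ) + 1) ^ 2 * C6 d * L ^ 2 * α₀ ≤ 1)
    (hs₆ : 16 * d * C5' d * C6 d * (L : ℝ) ^ 2 * α₀ ≤ 1) (hs₇ : 8 * d * C6 d * L * α₀ ≤ 1)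
    (hsm : α₃ + α₄ ≤ 1 / (4 * B₀' * (2 * C2p d))) :
    ∀ (j : ℕ), j ≤ k → ∀ z : Site d,
      Qnl L U₀ (fun x => expUnit ((lam - H' (Dprime L U₀ u₁ k H' (α₄ / (2 * B₀')) lam)) x)) u₁ j z =
        QprimeIter (zdBlocking d L) (bgT L U₀) j lam z := by
  obtain ⟨⟨hball, hfix⟩, -⟩ := Dprime_spec hL hG hU H' lam hα hα3 hα2 h52 hB hH0 hH1 h119a h119b hu₁ hα₃ hα₃' hs₁ hs₂ hs₃
    hs₄ hs₅ hs₆ hs₇ hsm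
  have hα₄ : 0 < α₄ := by linarith [norm_nonneg (lam 0), h119b 0]
  have hC6 : (0 : ℝ) ≤ C6 d := by unfold C6; linarith [one_le_C5 (d := d)]
  have hC4G : 0 ≤ C4G d L := by
    have h7 : (0 : ℝ) ≤ C7 d := by unfold C7 C6; linarith [one_le_C5 (d := d), C5'_nonneg (d := d)]
    have h4' := C4'_nonneg (d := d)
    unfold C4G; positivity
  have hs₁' : 200 * C6 d * α₄ ≤ 1 := by nlinarith
  have hs₂' : 12000 * ((d : ℝ) + 1) * L * α₄ ≤ 1 := by
    have : (0 : ℝ) ≤ 12000 * ((d : ℝ) + 1) * L := by positivity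
    nlinarith
  have hs₃' : C4G d L * (α₀ + α₃ + 4 * α₄) ≤ 1 := by nlinarith
  have hpt := eq1117_pointwise hL hG hU H' lam hα hα3 hα2 h52 hB hH0 hH1 h119a h119b hu₁ hα₃ hα₃' hs₁' hs₂' hs₃' hs₄ hs₅ hs₆
    hs₇ hball hfix
  exact eq1114_of_fixedPoint H' hQH hpt

end Dprime

end Literature.MathematicalPhysics.QuantumFieldTheory.Balaban1983to89.B8Eq1113Concrete

end
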